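import Summits.Ventures.HSemireg.WedgeHankelBoxSiegelIdealKernel
import Summits.Ventures.HSemireg.WedgeHankelSiegelIdealStable

/-!
# Venture HSemireg — THE BOX SIEGEL IDEAL (3/3): THE COMMON KERNEL OF ALL HANKEL BOXES IS THE BOX SIEGEL IDEAL, in every degree —
# `θ ∧ (v₀(q₀) ∧ ⋯ ∧ v_{n−1}(q_{n−1})) = 0` for EVERY tuple of classes `(q_i)` iff `θ ∈ boxSiegelIdeal_k`

HONEST FRAMING. Part of the Lean index of the computation cell `pub-hsemireg` (seat p10 gen 12, Sunday typer «UNIFORM-IN-n»).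
Finite-dimensional EXTERIOR ALGEBRA over a field ONLY: no variety, no cohomology theory, no sheaf, no Ext group, no semiregularity map;
nothing here says that HC / HC_CM / HC_AV holds; no Literature fact is declared or used.  Custodian versions as in (1/3): FORMULA-N PART A
§2.3 THEOREM K, §2.6 THEOREM H / FN-4 (i) («with v-independent kernel the Θ-isotropic part»); STRUCTURE.md v1.0-SIGNED 9b196a05977dd067 §1.1
C15 / Σ2.  The dictionary (`⌟(v₀ ⊠ ⋯ ⊠ v_{n−1})` on `HT^k(X₀ × ⋯ × X_{n−1})` ↦ `θ ↦ θ ∧ (v₀ ∧ ⋯ ∧ v_{n−1})`) is QUOTED, never asserted.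

WHAT IS KEYED.  (1/3), (2/3): `boxSiegelIdeal_k ≤ ker(θ ↦ θ ∧ F ∣ ⋀^k)` for every Hankel box `F`, `dim boxSiegelIdeal_k + [t^k] Π_i G_{m_i} =
C(Σ 2m_i, k)`, the complement `boxStd` (products of the factors' standard monomials), the excess law.  One factor (gen 11 `WedgeHankelSiegelIdealStable`,
row 669): `θ ∧ w_m(q) = 0 ∀q ⟹ θ ∈ SI_k` in EVERY degree.  THIS FILE (namespace `Summit.Ventures.HSemireg.Wedge.HankelBoxSiegelIdeal` continued):
* §9 generic tools (any generator type): graded commutation of homogeneous elements (`Hom_mul_comm`); products on one block (`Hom_mul_Hom_le_same`);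
  the monomial expansion on a block (`eq_sum_repr_smul_B`); **THE SEPARATION LEMMA `eq_zero_of_sum_B_mul_eq_zero`: `Σ_s E_s ∧ w_s = 0` with the `s`
  distinct subsets of `D₁` and `w_s ∈ Alg(D₂)`, `D₁ ∩ D₂ = ∅`, forces every `w_s = 0`** (coordinates of products on disjoint blocks, th-7's `coord_mul`);
  **THE BIDEGREE SEPARATION `eq_zero_of_sum_bideg_eq_zero`** (summands with pairwise different `D₁`-degrees are independent — disjoint monomial supports);
  the expansion `exists_sum_of_mem_mul_span` of an element of `M ∧ span{r_γ}` as `Σ_γ y_γ ∧ r_γ`, `y_γ ∈ M`.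
* §10 prefix products: `v₀ ∧ ⋯ ∧ v_{j−1}` is homogeneous on the first `j` blocks (`j = 0` included), does not see `q_j` (`prodR_hfac_update`), and is
  killed by `boxSI_j` (`mul_prodR_eq_zero_of_mem_boxSI`).
* §11 **THE COMMON KERNEL THEOREM `mem_boxSI_of_forall_mul_prodR`** (induction on the number of factors `j ≤ n`): a `k`-form `θ` on the first `j`
  blocks with `θ ∧ (v₀(q) ∧ ⋯ ∧ v_{j−1}(q)) = 0` for EVERY `q` lies in `boxSI_j^k`.  Step: split `θ` along `Hom = boxStd ⊕ boxSI` (2/3); expand the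
  standard part as `Σ_a Σ_γ y_{aγ} ∧ emb_j(r_γ)` over the factor-`j` standard monomials `r_γ`; separate bidegrees; freeze `q` below `j` and vary
  `q_j = ρ`; expand `y_{aγ} ∧ P_j(q)` in monomials `E_s` (`s ⊆ pre j`) and separate: `(Σ_γ c_{γs} r_γ) ∧ w_{m_j}(ρ) = 0` for every `ρ`, so by the
  one-factor common kernel `Σ_γ c_{γs} r_γ ∈ SI ∩ span{r_γ} = 0`, all `c = 0`, i.e. `y_{aγ} ∧ P_j(q) = 0` for every `q`; the induction hypothesis puts
  `y_{aγ}` in `boxSI_j ∩ boxStd_j = 0`.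
  Hence **`mem_boxSiegelIdeal_iff_forall_mul_hankelBox`: for `θ ∈ ⋀^k`, `θ ∈ boxSiegelIdeal_k ⟺ θ ∧ F_q = 0` for every tuple `q = (q_i)`** and
  **`iInf_ker_wedge_hankelBox`: `⋂_q ker(θ ↦ θ ∧ F_q ∣ ⋀^k) = boxSiegelIdeal_k`** — th-6's «v-independent kernel = the Θ-isotropic part» FOR BOXES,
  in every degree, for every field, number of factors and dimensions (BOXES-PLAN-p10g11 (B4) CLOSED; no factorwise stabilisation needed beyond the
  one-factor theorem).
NOT typed (honest): finite test families of box classes detecting `boxSiegelIdeal_k` (one factor: `{E_0, …, E_m}`); anything Ext-side.  Class side only.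
-/

open Module

namespace Summit.Ventures.HSemireg.Wedge.HankelBoxSiegelIdeal

open Summit.Ventures.HSemireg.Wedge Summit.Ventures.HSemireg.Wedge.Kunneth Summit.Ventures.HSemireg.Wedge.MixedBox
  Summit.Ventures.HSemireg.Wedge.HankelSiegel Summit.Ventures.HSemireg.Wedge.HankelSiegelIdeal
  Summit.Ventures.HSemireg.Wedge.HankelBox

variable (K : Type*) [Field K]

/-! ## §9. Generic tools: graded commutation, separation by coordinates, bidegrees, expansion over a spanning family -/

section Generic

variable {I : Type*} [LinearOrder I] [Fintype I]

/-- graded commutation of homogeneous elements: `g ∧ f = (−1)^{d'd} f ∧ g` for `f ∈ Hom(D, d)`, `g ∈ Hom(D', d')`. -/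
lemma Hom_mul_comm {D D' : Finset I} {d d' : ℕ} {f g : HT K I} (hf : f ∈ Hom K I D d) (hg : g ∈ Hom K I D' d') :
    g * f = ((-1 : K) ^ (d' * d)) • (f * g) := by
  induction hg using Submodule.span_induction with
  | mem x hx =>
    obtain ⟨t, ht, rfl⟩ := hx
    rw [B_mul_comm_of_mem_Hom K hf t, ht.2]
  | zero => rw [zero_mul, mul_zero, smul_zero]
  | add x y _ _ hx hy => rw [add_mul, mul_add, smul_add, hx, hy]
  | smul c x _ hx => rw [smul_mul_assoc, mul_smul_comm, hx, smul_comm]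

/-- products of homogeneous elements on ONE block: `Hom(D, a) ∧ Hom(D, d) ≤ Hom(D, a + d)`. -/
lemma Hom_mul_Hom_le_same (D : Finset I) (a d : ℕ) : Hom K I D a * Hom K I D d ≤ Hom K I D (a + d) := by
  rw [Submodule.mul_le]
  intro f hf g hg
  induction hf using Submodule.span_induction with
  | mem x hx =>
    obtain ⟨s, hs, rfl⟩ := hx
    rw [← hs.2]
    exact B_mul_mem_Hom K hs.1 hg
  | zero => rw [zero_mul]; exact Submodule.zero_mem _
  | add x y _ _ hx hy => rw [add_mul]; exact Submodule.add_mem _ hx hy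
  | smul c x _ hx => rw [smul_mul_assoc]; exact Submodule.smul_mem _ _ hx

/-- the empty monomial is `1` (any generator type). -/
lemma B_empty' : B K I (∅ : Finset I) = 1 := by
  rw [B, ExteriorAlgebra.basis_apply_ofCard (b K I) Finset.card_empty]
  simp [ExteriorAlgebra.ιMulti_family]

/-- the MONOMIAL EXPANSION on a block: `w = Σ_{s ⊆ D} w_s · E_s` for `w ∈ Alg(D)`. -/
lemma eq_sum_repr_smul_B {D : Finset I} {w : HT K I} (hw : w ∈ Alg K I D) :
    w = ∑ s ∈ D.powerset, (B K I).repr w s • B K I s := by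
  conv_lhs => rw [← (B K I).sum_repr w]
  symm
  apply Finset.sum_subset (Finset.subset_univ _)
  intro s _ hs
  rw [Finset.mem_powerset] at hs
  rw [← Basis.coord_apply, coord_eq_zero_of_mem_Alg K hw hs, zero_smul]

/-- **THE SEPARATION LEMMA**: `Σ_{s ∈ 𝒮} E_s ∧ w_s = 0` with `𝒮` a set of subsets of `D₁`, every `w_s ∈ Alg(D₂)` and `D₁ ∩ D₂ = ∅` forces `w_s = 0` for
every `s ∈ 𝒮` (the coordinate of the sum at `s ∪ s₂` is `± (w_s)_{s₂}`: th-7's `coord_mul`). -/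
theorem eq_zero_of_sum_B_mul_eq_zero {D₁ D₂ : Finset I} (hD : Disjoint D₁ D₂) {𝒮 : Finset (Finset I)} (h𝒮 : ∀ s ∈ 𝒮, s ⊆ D₁)
    {w : Finset I → HT K I} (hw : ∀ s ∈ 𝒮, w s ∈ Alg K I D₂) (h : ∑ s ∈ 𝒮, B K I s * w s = 0) : ∀ s ∈ 𝒮, w s = 0 := by
  classical
  intro s hs
  apply eq_zero_of_coord_eq_zero K (hw s hs)
  intro s₂ hs₂
  have h0 := congrArg ((B K I).coord (s ∪ s₂)) h
  rw [map_sum, map_zero, Finset.sum_eq_single s] at h0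
  · rw [coord_mul K hD (B_mem_Alg K (h𝒮 s hs)) (hw s hs) (h𝒮 s hs) hs₂, coord_B_B, if_pos rfl, mul_one] at h0
    exact (mul_eq_zero.mp h0).resolve_left ((u_ne_zero_iff K).mpr (disjoint_of_subsets hD (h𝒮 s hs) hs₂))
  · intro s' hs' hne
    rw [coord_mul K hD (B_mem_Alg K (h𝒮 s' hs')) (hw s' hs') (h𝒮 s hs) hs₂, coord_B_B, if_neg hne, mul_zero, zero_mul]
  · intro hs'
    exact absurd hs hs'

omit [Fintype I] in
/-- `(s ∪ t) ∩ D₁ = s` for `s ⊆ D₁` and `t` disjoint from `D₁`. -/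
lemma union_inter_eq_left {D₁ s t : Finset I} (hs : s ⊆ D₁) (ht : Disjoint t D₁) : (s ∪ t) ∩ D₁ = s := by
  rw [Finset.union_inter_distrib_right, Finset.inter_eq_left.mpr hs, Finset.disjoint_iff_inter_eq_empty.mp ht, Finset.union_empty]

/-- `Hom(D₁, e) ∧ Alg(D₂)` is supported on monomials of `D₁`-degree exactly `e`. -/
lemma Hom_mul_Alg_le_Sp {D₁ D₂ : Finset I} (hD : Disjoint D₁ D₂) (e : ℕ) :
    Hom K I D₁ e * Alg K I D₂ ≤ Weil.Sp K (fun r : Finset I => (r ∩ D₁).card = e) := by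
  rw [Submodule.mul_le]
  intro f hf g hg
  refine Weil.mul_mem_Sp (P := fun s => s ⊆ D₁ ∧ s.card = e) (Q := fun t => t ⊆ D₂) (fun s t _ hs ht => ?_) hf hg
  rw [union_inter_eq_left hs.1 (Finset.disjoint_of_subset_left ht hD.symm), hs.2]

/-- **BIDEGREE SEPARATION**: a sum `Σ_{a ∈ A} z_a = 0` with `z_a ∈ Hom(D₁, e a) ∧ Alg(D₂)` and `e` injective forces every `z_a = 0`. -/
theorem eq_zero_of_sum_bideg_eq_zero {D₁ D₂ : Finset I} (hD : Disjoint D₁ D₂) {A : Finset ℕ} {e : ℕ → ℕ} (he : Function.Injective e)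
    {z : ℕ → HT K I} (hz : ∀ a ∈ A, z a ∈ Hom K I D₁ (e a) * Alg K I D₂) (h : ∑ a ∈ A, z a = 0) : ∀ a ∈ A, z a = 0 := by
  classical
  intro a ha
  have hSp : ∀ a' ∈ A, z a' ∈ Weil.Sp K (fun r : Finset I => (r ∩ D₁).card = e a') := fun a' ha' => Hom_mul_Alg_le_Sp K hD (e a') (hz a' ha')
  have hza : z a = -∑ a' ∈ A.erase a, z a' := by
    rw [← Finset.add_sum_erase A z ha] at h
    exact eq_neg_of_add_eq_zero_left h
  have h2 : z a ∈ Weil.Sp K (fun r : Finset I => ∃ a' ∈ A.erase a, (r ∩ D₁).card = e a') := by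
    rw [hza]
    exact Submodule.neg_mem _ (Submodule.sum_mem _ fun a' ha' =>
      Weil.Sp_mono (fun r hr => ⟨a', ha', hr⟩) (hSp a' (Finset.mem_of_mem_erase ha')))
  exact Weil.eq_zero_of_mem_Sp_of_mem_Sp (fun r hr ⟨a', ha', hr'⟩ => Finset.ne_of_mem_erase ha' (he (hr'.symm.trans hr))) (hSp a ha) h2

omit [LinearOrder I] [Fintype I] in
/-- expansion over a spanning family: an element of `M ∧ span{r_γ}` is `Σ_γ y_γ ∧ r_γ` with every `y_γ ∈ M`. -/
lemma exists_sum_of_mem_mul_span {M : Submodule K (HT K I)} {γ : Type*} [Fintype γ] (r : γ → HT K I) {z : HT K I}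
    (hz : z ∈ M * Submodule.span K (Set.range r)) : ∃ y : γ → HT K I, (∀ c, y c ∈ M) ∧ z = ∑ c, y c * r c := by
  refine Submodule.mul_induction_on (C := fun z => ∃ y : γ → HT K I, (∀ c, y c ∈ M) ∧ z = ∑ c, y c * r c) hz ?_ ?_
  · intro x hx v hv
    obtain ⟨c, rfl⟩ := Submodule.mem_span_range_iff_exists_fun K |>.mp hv
    refine ⟨fun g => c g • x, fun g => M.smul_mem _ hx, ?_⟩
    rw [Finset.mul_sum]
    exact Finset.sum_congr rfl fun g _ => by rw [mul_smul_comm, smul_mul_assoc]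
  · rintro x x' ⟨y₁, h₁, rfl⟩ ⟨y₂, h₂, rfl⟩
    exact ⟨y₁ + y₂, fun g => M.add_mem (h₁ g) (h₂ g), by rw [← Finset.sum_add_distrib]; simp only [Pi.add_apply, add_mul]⟩

end Generic

/-! ## §10. Prefix products `v₀ ∧ ⋯ ∧ v_{j−1}` -/

section Box

variable {n : ℕ} (m : Fin n → ℕ)

/-- block `j < n`, spelled with the `Fin` index `⟨j, hj⟩`. -/
lemma blk_eq {j : ℕ} (hj : j < n) : blk m j = Finset.univ.map (facEmb m ⟨j, hj⟩).toEmbedding := by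
  rw [blk, dif_pos hj]

/-- every prefix product `v₀ ∧ ⋯ ∧ v_{j−1}` (`j ≤ n`, `j = 0` included) is homogeneous of degree `Σ_{i<j} m_i` on the first `j` blocks
(the product Siegel files spell the degree as gen 6's `Σ_{i<j} (m_i if i < n else 0)`). -/
lemma prodR_hfac_mem_Hom' (q : Fin n → ℕ → K) {j : ℕ} (hj : j ≤ n) :
    prodR K (hfac K m q) j ∈ Hom K (Gen m) (pre m j) (∑ i ∈ Finset.range j, if h : i < n then m ⟨i, h⟩ else 0) := by
  rcases Nat.eq_zero_or_pos j with rfl | hpos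
  · rw [pre_zero, Finset.sum_range_zero, show prodR K (hfac K m q) 0 = 1 from rfl, ← B_empty' K]
    exact B_mem_Hom K (Finset.empty_subset _) Finset.card_empty
  · exact prodR_hfac_mem_Hom K m q hpos hj

/-- the prefix product does not see the later classes: updating `q_i`, `i ≥ j`, does not change `v₀ ∧ ⋯ ∧ v_{j−1}`. -/
lemma prodR_hfac_update (q : Fin n → ℕ → K) (i : Fin n) (ρ : ℕ → K) : ∀ {j : ℕ}, j ≤ (i : ℕ) →
    prodR K (hfac K m (Function.update q i ρ)) j = prodR K (hfac K m q) j := by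
  intro j
  induction j with
  | zero => intro; rfl
  | succ j ih =>
    intro hj
    have hji : (⟨j, by omega⟩ : Fin n) ≠ i := fun h => by have := congrArg Fin.val h; simp at this; omega
    rw [prodR_succ, prodR_succ, ih (by omega), hfac, hfac, dif_pos (by omega : j < n), dif_pos (by omega : j < n),
      Function.update_of_ne hji]

/-- the updated factor: `v_j(ρ) = emb_j(w_{m_j}(ρ))`. -/
lemma hfac_update_self (q : Fin n → ℕ → K) {j : ℕ} (hj : j < n) (ρ : ℕ → K) :
    hfac K m (Function.update q ⟨j, hj⟩ ρ) j = emb K (facEmb m ⟨j, hj⟩) (Hankel.w K (m ⟨j, hj⟩) (m ⟨j, hj⟩) ρ) := by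
  rw [hfac, dif_pos hj, Function.update_self]

/-- **`boxSI_j` is killed by every prefix product `v₀ ∧ ⋯ ∧ v_{J−1}`, `j ≤ J ≤ n`.** -/
theorem mul_prodR_eq_zero_of_mem_boxSI {j J k : ℕ} (hjJ : j ≤ J) (hJ : J ≤ n) {θ : HT K (Gen m)} (hθ : θ ∈ boxSI K m j k)
    (q : Fin n → ℕ → K) : θ * prodR K (hfac K m q) J = 0 := by
  induction hθ using Submodule.span_induction with
  | mem x hx =>
    obtain ⟨⟨t, ⟨i, p⟩⟩, ⟨-, -, hi⟩, rfl⟩ := hx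
    have h := emb_mul_prodR_hfac_eq_zero K m q i.2 (θ₀ := sgen K p) (Submodule.subset_span ⟨p, rfl⟩) J (by simp only at hi; omega) hJ
    rw [mul_assoc, show bsgen K m ⟨i, p⟩ = emb K (facEmb m ⟨i, i.2⟩) (sgen K p) from rfl, h, mul_zero]
  | zero => rw [zero_mul]
  | add x y _ _ hx hy => rw [add_mul, hx, hy, add_zero]
  | smul c x _ hx => rw [smul_mul_assoc, hx, smul_zero]

/-- the standard part of factor `j` as the span of the embedded standard monomials. -/
lemma R_eq_span (i : Fin n) (b : ℕ) :
    R K m i b = Submodule.span K (Set.range fun γ : RIdx (m i) b => emb K (facEmb m i) (rep K γ)) := by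
  rw [R, repSpan, Submodule.map_span, ← Set.range_comp]
  rfl

/-! ## §11. The common kernel theorem -/

/-- ONE FROZEN PREFIX: if `Σ_γ Y_γ ∧ (emb_j(r_γ) ∧ emb_j(w_{m_j}(ρ))) = 0` for EVERY `ρ`, with `Y_γ ∈ Alg(pre j)` and `r_γ` the factor-`j` standard
monomials of degree `b`, then every `Y_γ = 0` (separation by the monomials of `Alg(pre j)`, then the one-factor common kernel and `span{r_γ} ∩ SI = 0`). -/
theorem eq_zero_of_forall_sum_mul_emb {j : ℕ} (hj : j < n) {b : ℕ} {Y : RIdx (m ⟨j, hj⟩) b → HT K (Gen m)}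
    (hY : ∀ γ, Y γ ∈ Alg K (Gen m) (pre m j))
    (h : ∀ ρ : ℕ → K, ∑ γ, Y γ * (emb K (facEmb m ⟨j, hj⟩) (rep K γ) *
      emb K (facEmb m ⟨j, hj⟩) (Hankel.w K (m ⟨j, hj⟩) (m ⟨j, hj⟩) ρ)) = 0) : ∀ γ, Y γ = 0 := by
  classical
  set φ := facEmb m ⟨j, hj⟩ with hφ
  set c : RIdx (m ⟨j, hj⟩) b → Finset (Gen m) → K := fun γ s => (B K (Gen m)).repr (Y γ) s with hc
  -- regroup the sum by monomials of `Alg(pre j)`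
  have hregroup : ∀ ρ : ℕ → K, ∑ s ∈ (pre m j).powerset, B K (Gen m) s *
      (emb K φ ((∑ γ, c γ s • rep K γ) * Hankel.w K (m ⟨j, hj⟩) (m ⟨j, hj⟩) ρ)) = 0 := by
    intro ρ
    rw [← h ρ]
    simp_rw [map_mul, map_sum, map_smul, Finset.sum_mul, Finset.mul_sum, smul_mul_assoc, mul_smul_comm, ← mul_assoc]
    rw [Finset.sum_comm]
    refine Finset.sum_congr rfl fun γ _ => ?_
    conv_rhs => rw [eq_sum_repr_smul_B K (hY γ), Finset.sum_mul, Finset.sum_mul]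
    refine Finset.sum_congr rfl fun s _ => ?_
    rw [smul_mul_assoc, smul_mul_assoc]
  -- separation: every regrouped coefficient vanishes, for every `ρ`
  have hsep : ∀ s ∈ (pre m j).powerset, ∀ ρ : ℕ → K, (∑ γ, c γ s • rep K γ) * Hankel.w K (m ⟨j, hj⟩) (m ⟨j, hj⟩) ρ = 0 := by
    intro s hs ρ
    have h0 := eq_zero_of_sum_B_mul_eq_zero K (disjoint_pre_blk m hj) (fun s hs => Finset.mem_powerset.mp hs)
      (w := fun s => emb K φ ((∑ γ, c γ s • rep K γ) * Hankel.w K (m ⟨j, hj⟩) (m ⟨j, hj⟩) ρ))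
      (fun s _ => by
        rw [blk_eq m hj]
        exact Hom_le_Alg K _ _ (emb_mem_Hom K φ (Hom_mul_Hom_le_same K _ _ _ (Submodule.mul_mem_mul
          (by rw [← Hankel.exteriorPower_eq_Hom_univ]; exact repSpan_le_exteriorPower K b (Submodule.sum_mem _ fun γ _ =>
            Submodule.smul_mem _ _ (Submodule.subset_span ⟨γ, rfl⟩)))
          (w_top_mem_Hom K ρ)))))
      (hregroup ρ) s hs
    simpa only [map_eq_zero_iff _ (emb_injective K φ)] using h0
  -- one-factor common kernel: the coefficient vector lies in `SI ∩ span{r_γ} = 0`, so all `c γ s = 0`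
  have hc0 : ∀ s ∈ (pre m j).powerset, ∀ γ, c γ s = 0 := by
    intro s hs
    have hrep : ∑ γ, c γ s • rep K γ ∈ repSpan K (m ⟨j, hj⟩) b :=
      Submodule.sum_mem _ fun γ _ => Submodule.smul_mem _ _ (Submodule.subset_span ⟨γ, rfl⟩)
    have hSI : ∑ γ, c γ s • rep K γ ∈ siegelIdeal K (m ⟨j, hj⟩) b :=
      mem_siegelIdeal_of_forall_mul_w K (repSpan_le_exteriorPower K b hrep) (hsep s hs)
    have h0 : ∑ γ, c γ s • rep K γ = 0 := by
      rw [← Submodule.mem_bot K, ← repSpan_inf_siegelIdeal K b]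
      exact ⟨hrep, hSI⟩
    exact fun γ => Fintype.linearIndependent_iff.mp (linearIndependent_rep K b) (fun γ => c γ s) h0 γ
  -- conclude: all coordinates of `Y γ` vanish
  intro γ
  rw [eq_sum_repr_smul_B K (hY γ)]
  exact Finset.sum_eq_zero fun s hs => by rw [show (B K (Gen m)).repr (Y γ) s = c γ s from rfl, hc0 s hs γ, zero_smul]

/-- **THE COMMON KERNEL THEOREM (prefix form, induction on the number of factors)**: for `j ≤ n`, a `k`-form `θ` on the first `j` blocks with
`θ ∧ (v₀(q) ∧ ⋯ ∧ v_{j−1}(q)) = 0` for EVERY tuple of classes `q` lies in the box Siegel ideal `boxSI_j^k`. -/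
theorem mem_boxSI_of_forall_mul_prodR : ∀ {j : ℕ}, j ≤ n → ∀ {k : ℕ} {θ : HT K (Gen m)}, θ ∈ Hom K (Gen m) (pre m j) k →
    (∀ q : Fin n → ℕ → K, θ * prodR K (hfac K m q) j = 0) → θ ∈ boxSI K m j k := by
  classical
  intro j
  induction j with
  | zero =>
    intro _ k θ _ h
    have h0 := h fun _ _ => 0
    rw [show prodR K (hfac K m fun _ _ => (0 : K)) 0 = 1 from rfl, mul_one] at h0
    rw [h0]
    exact Submodule.zero_mem _
  | succ j ih =>
    intro hj k θ hθ h
    have hj' : j < n := by omega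
    -- split θ along Hom = boxStd ⊕ boxSI
    rw [← boxStd_sup_boxSI K m hj k, Submodule.mem_sup] at hθ
    obtain ⟨σ, hσ, ι, hι, rfl⟩ := hθ
    have hσ0 : ∀ q : Fin n → ℕ → K, σ * prodR K (hfac K m q) (j + 1) = 0 := by
      intro q
      have := h q
      rwa [add_mul, mul_prodR_eq_zero_of_mem_boxSI K m le_rfl hj hι q, add_zero] at this
    suffices hσz : σ = 0 by rw [hσz, zero_add]; exact hι
    -- expand σ = Σ_a σ_a, σ_a = Σ_γ y a γ ∧ emb_j(r_γ)
    rw [boxStd_succ K m hj', Submodule.mem_iSup_finset_iff_exists_sum] at hσ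
    obtain ⟨μ, rfl⟩ := hσ
    have hexp : ∀ a, ∃ y : RIdx (m ⟨j, hj'⟩) (k - a) → HT K (Gen m), (∀ γ, y γ ∈ boxStd K m j a) ∧
        (μ a : HT K (Gen m)) = ∑ γ, y γ * emb K (facEmb m ⟨j, hj'⟩) (rep K γ) := by
      intro a
      have hμ : (μ a : HT K (Gen m)) ∈ boxStd K m j a *
          Submodule.span K (Set.range fun γ : RIdx (m ⟨j, hj'⟩) (k - a) => emb K (facEmb m ⟨j, hj'⟩) (rep K γ)) := by
        rw [← R_eq_span]; exact (μ a).2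
      exact exists_sum_of_mem_mul_span K _ hμ
    choose y hy hμy using hexp
    -- it suffices that every y a γ vanishes
    suffices hy0 : ∀ a ∈ Finset.range (k + 1), ∀ γ, y a γ = 0 by
      exact Finset.sum_eq_zero fun a ha => by rw [hμy a]; exact Finset.sum_eq_zero fun γ _ => by rw [hy0 a ha γ, zero_mul]
    -- the relation, bidegree by bidegree: z_a(q) := Σ_γ (y ∧ P_j(q)) ∧ (emb_j r_γ ∧ v_j(q))
    set P : (Fin n → ℕ → K) → HT K (Gen m) := fun q => prodR K (hfac K m q) j with hP
    set M : ℕ := ∑ i ∈ Finset.range j, if h : i < n then m ⟨i, h⟩ else 0 with hM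
    have hPmem : ∀ q, P q ∈ Hom K (Gen m) (pre m j) M := fun q => prodR_hfac_mem_Hom' K m q (by omega)
    have hrel : ∀ q a, a ∈ Finset.range (k + 1) →
        ∑ γ, (y a γ * P q) * (emb K (facEmb m ⟨j, hj'⟩) (rep K γ) * hfac K m q j) = 0 := by
      intro q
      -- the whole relation, regrouped with the sign `(−1)^{(k−a)·M}` per bidegree (`M = Σ_{i<j} m_i`)
      have hz : ∑ a ∈ Finset.range (k + 1), ((-1 : K) ^ ((k - a) * M)) •
          ∑ γ, (y a γ * P q) * (emb K (facEmb m ⟨j, hj'⟩) (rep K γ) * hfac K m q j) = 0 := by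
        rw [← hσ0 q, prodR_succ, Finset.sum_mul]
        refine Finset.sum_congr rfl fun a _ => ?_
        rw [hμy a, Finset.sum_mul, Finset.smul_sum]
        refine Finset.sum_congr rfl fun γ _ => ?_
        have hr : emb K (facEmb m ⟨j, hj'⟩) (rep K γ) ∈ Hom K (Gen m) (blk m j) (k - a) := by
          rw [blk_eq m hj']; exact emb_mem_Hom K _ (by rw [← Hankel.exteriorPower_eq_Hom_univ]; exact rep_mem_exteriorPower K γ)
        rw [show y a γ * emb K (facEmb m ⟨j, hj'⟩) (rep K γ) * (prodR K (hfac K m q) j * hfac K m q j) =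
          y a γ * (emb K (facEmb m ⟨j, hj'⟩) (rep K γ) * prodR K (hfac K m q) j) * hfac K m q j by noncomm_ring,
          Hom_mul_comm K (hPmem q) hr, mul_smul_comm, smul_mul_assoc]
        simp only [mul_assoc]
      have hzmem : ∀ a ∈ Finset.range (k + 1), ((-1 : K) ^ ((k - a) * M)) •
          ∑ γ, (y a γ * P q) * (emb K (facEmb m ⟨j, hj'⟩) (rep K γ) * hfac K m q j) ∈
            Hom K (Gen m) (pre m j) (a + M) * Alg K (Gen m) (blk m j) := by
        intro a ha
        refine Submodule.smul_mem _ _ (Submodule.sum_mem _ fun γ _ => Submodule.mul_mem_mul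
          (Hom_mul_Hom_le_same K _ _ _ (Submodule.mul_mem_mul (boxStd_le_Hom K m (by omega) a (hy a γ)) (hPmem q))) ?_)
        rw [blk_eq m hj']
        exact mul_mem_Alg K (Hom_le_Alg K _ _ (emb_mem_Hom K _ (by rw [← Hankel.exteriorPower_eq_Hom_univ]; exact rep_mem_exteriorPower K γ)))
          (Hom_le_Alg K _ _ (by rw [← blk_eq m hj']; exact hfac_mem_Hom K m q hj'))
      intro a ha
      have h0 := eq_zero_of_sum_bideg_eq_zero K (disjoint_pre_blk m hj') (e := fun a => a + M)
        (fun a a' h => by simpa using h) hzmem hz a ha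
      exact (smul_eq_zero.mp h0).resolve_left (pow_ne_zero _ (neg_ne_zero.mpr one_ne_zero))
    -- freeze q below j, vary q_j = ρ, and separate: y a γ ∧ P_j(q) = 0 for every q
    have hyP : ∀ a ∈ Finset.range (k + 1), ∀ q γ, y a γ * P q = 0 := by
      intro a ha q
      refine eq_zero_of_forall_sum_mul_emb K m hj' (fun γ => Hom_le_Alg K _ _
        (Hom_mul_Hom_le_same K _ _ _ (Submodule.mul_mem_mul (boxStd_le_Hom K m (by omega) a (hy a γ)) (hPmem q)))) fun ρ => ?_
      have h1 := hrel (Function.update q ⟨j, hj'⟩ ρ) a ha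
      simp only [hP, prodR_hfac_update K m q ⟨j, hj'⟩ ρ le_rfl, hfac_update_self K m q hj' ρ] at h1
      exact h1
    -- induction hypothesis: y a γ ∈ boxSI_j ∩ boxStd_j = 0
    intro a ha γ
    have h1 : y a γ ∈ boxSI K m j a := ih (by omega) (boxStd_le_Hom K m (by omega) a (hy a γ)) (hyP a ha · γ)
    rw [← Submodule.mem_bot K, ← boxStd_inf_boxSI K m (by omega : j ≤ n) a]
    exact ⟨hy a γ, h1⟩

/-- **THE COMMON KERNEL OF ALL HANKEL BOXES IS THE BOX SIEGEL IDEAL: for `θ ∈ ⋀^k`, `θ ∈ boxSiegelIdeal_k ⟺ θ ∧ (v₀ ∧ ⋯ ∧ v_{n−1}) = 0` for EVERY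
tuple of classes `(q_i)`** — every field, every number of factors, every dimensions, EVERY degree (th-6's «v-independent kernel = the Θ-isotropic
part» for boxes). -/
theorem mem_boxSiegelIdeal_iff_forall_mul_hankelBox {k : ℕ} {θ : HT K (Gen m)} (hθ : θ ∈ ⋀[K]^k (Gen m → K)) :
    θ ∈ boxSiegelIdeal K m k ↔ ∀ q : Fin n → ℕ → K, θ * hankelBox K m q = 0 := by
  refine ⟨fun h q => mul_hankelBox_eq_zero_of_mem_boxSI K m h q, fun h => ?_⟩
  rw [exteriorPower_eq_Hom_univ_gen, ← pre_top m] at hθ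
  exact mem_boxSI_of_forall_mul_prodR K m le_rfl hθ h

/-- **`⋂_q ker(θ ↦ θ ∧ F_q ∣ ⋀^k) = boxSiegelIdeal_k`** (the box Siegel ideal read inside `⋀^k` along its inclusion). -/
theorem iInf_ker_wedge_hankelBox (k : ℕ) :
    (⨅ q : Fin n → ℕ → K, LinearMap.ker (wedge K (Gen m) k (hankelBox K m q))) =
      (boxSiegelIdeal K m k).comap (⋀[K]^k (Gen m → K)).subtype := by
  apply le_antisymm
  · intro θ hθ
    refine (mem_boxSiegelIdeal_iff_forall_mul_hankelBox K m θ.2).mpr fun q => ?_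
    have := (Submodule.mem_iInf _).mp hθ q
    rwa [LinearMap.mem_ker, wedge, LinearMap.comp_apply, Submodule.subtype_apply, LinearMap.mulRight_apply] at this
  · exact le_iInf fun q => boxSiegelIdeal_le_ker K m k q

/-- equivalently: **a `k`-form outside the box Siegel ideal is DETECTED by some Hankel box** (`θ ∧ F_q ≠ 0` for some tuple `q`). -/
theorem exists_mul_hankelBox_ne_zero {k : ℕ} {θ : HT K (Gen m)} (hθ : θ ∈ ⋀[K]^k (Gen m → K)) (hnot : θ ∉ boxSiegelIdeal K m k) :
    ∃ q : Fin n → ℕ → K, θ * hankelBox K m q ≠ 0 := by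
  by_contra h
  exact hnot ((mem_boxSiegelIdeal_iff_forall_mul_hankelBox K m hθ).mpr fun q => not_not.mp (not_exists.mp h q))

end Box

end Summit.Ventures.HSemireg.Wedge.HankelBoxSiegelIdeal
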